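import Summits.AtomisticToContinuum.FouriersLaw.Theorems.OddSectorIrreversibilityOddDensityIsCorrectorCutoff
import Summits.AtomisticToContinuum.FouriersLaw.Theorems.OddSectorIrreversibilityOddDensityIsCorrectorGibbsIBP

/-!
# `OddDensityIsCorrector`, part 4b: `L²(μ_T)` eigenfunctions of `L` with positive eigenvalue vanish

Helper file for support item `stmt-AtomisticToContinuum-9146`
(`OddSectorIrreversibility.OddDensityIsCorrector`).

The dissipativity estimate behind the density of `Range(λ - L)|C_c^∞` in `L²(μ_T)` (essential
m-dissipativity of the equilibrium generator on test functions): for the pinned anharmonic chain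
(`ω₂ > 0`, `lam, β ≥ 0`, `γ ≥ 0`, `N ≥ 2`, `T > 0`), `λ > 0`, and a CLASSICAL solution `k ∈ C²` of
`L k = λ k` with `∫ k² e^{-H/T} < ∞`, one has `k = 0` (`eq_zero_of_generator_eq_smul`).
Proof (energy estimate with the energy cutoffs `χ_R = χ(H/R)` of the previous file): multiply by
`k χ_R² e^{-H/T}` and integrate; the Liouville part drops out exactly (antisymmetry in `L²(μ_T)`,
`integral_liouville_mul_mul_gibbsDensity`, and `{H, χ_R²} = 0`), each bath term is
`-T ∫ ∂_{p_b}(kχ_R²) ∂_{p_b}k e^{-H/T} ≤ T ∫ k² (∂_{p_b}χ_R)² e^{-H/T} ≤ (4M²T/R) ∫ k² e^{-H/T}`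
(symmetry of the Ornstein–Uhlenbeck taps and the carré du champ,
`integral_bath_mul_gibbsDensity_eq_neg`, completing the square), so
`λ ∫ k²χ_R² e^{-H/T} ≤ (8γTM²/R) ∫ k² e^{-H/T} → 0` while the left side tends to `λ ∫ k² e^{-H/T}`.
Nothing here closes an item.
-/

noncomputable section

open MeasureTheory Filter Topology Set Function
open scoped ContDiff
open Literature.MathematicalPhysics.KineticTheory.HeatConduction
open Summit.AtomisticToContinuum.FouriersLaw.Theorems.SubdiffusiveBondHeat

namespace Summit.AtomisticToContinuum.FouriersLaw.Theorems.OddSectorIrreversibility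

variable {N : ℕ}

/-! ### The carré du champ of a bath term -/

/-- **Carré du champ of an Ornstein–Uhlenbeck tap**: for `F ∈ C²_c`, `k ∈ C¹`, `T ≠ 0`,
`∫ (T ∂²_{p_i}F - p_i ∂_{p_i}F) k e^{-H/T} = -T ∫ ∂_{p_i}F ∂_{p_i}k e^{-H/T}` (one integration by
parts; `∂_{p_i} e^{-H/T} = -(p_i/T) e^{-H/T}`). [cite: CuneoEckmannHairerReyBellet2018, §3.1] -/
theorem integral_bath_mul_gibbsDensity_eq_neg (P : OscillatorChain) (hU : ContDiff ℝ 1 P.U)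
    (hV : ContDiff ℝ 1 P.V) (N : ℕ) {T : ℝ} (hT : T ≠ 0) {F k : PhaseSpace N → ℝ} (hF : ContDiff ℝ 2 F)
    (hFc : HasCompactSupport F) (hk : ContDiff ℝ 1 k) (i : Fin N) :
    ∫ x, (T * partialP i (partialP i F) x - x.2 i * partialP i F x) * k x * P.gibbsDensity N T x =
      -T * ∫ x, partialP i F x * partialP i k x * P.gibbsDensity N T x := by
  have hFd : Differentiable ℝ F := hF.differentiable two_ne_zero
  have hkd : Differentiable ℝ k := hk.differentiable one_ne_zero
  have hF1 : ContDiff ℝ 1 (partialP i F) := contDiff_partialP hF (by norm_num) i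
  have hF1d : Differentiable ℝ (partialP i F) := hF1.differentiable one_ne_zero
  have hρc : Continuous (P.gibbsDensity N T) := P.continuous_gibbsDensity hU.continuous hV.continuous N T
  have hPc : Continuous (partialP i F) := hF1.continuous
  have hPPc : Continuous (partialP i (partialP i F)) := continuous_partialP hF1 one_ne_zero i
  have hPkc : Continuous (partialP i k) := continuous_partialP hk one_ne_zero i
  have hpc : Continuous fun x : PhaseSpace N => x.2 i := (continuous_apply i).comp continuous_snd
  have hPcs : HasCompactSupport (partialP i F) := hasCompactSupport_partialP hFd hFc i
  have hPPcs : HasCompactSupport (partialP i (partialP i F)) := hasCompactSupport_partialP hF1d hPcs i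
  have hline : ∀ x : PhaseSpace N, HasLineDerivAt ℝ (fun y => k y * P.gibbsDensity N T y)
      (partialP i k x * P.gibbsDensity N T x + k x * (-(x.2 i / T) * P.gibbsDensity N T x)) x
      ((0, Pi.single i 1) : PhaseSpace N) := by
    intro x
    have hρ' := P.hasLineDerivAt_gibbsDensity (T := T) (P.hasLineDerivAt_hamiltonian_unitP N x i)
    have hk' := hasLineDerivAt_partialP hkd i x
    unfold HasLineDerivAt at hρ' hk' ⊢
    have := hk'.mul hρ'
    simp only [zero_smul, add_zero] at this
    exact this
  have e1 := integral_mul_eq_neg_of_hasLineDerivAt (v := ((0, Pi.single i 1) : PhaseSpace N))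
    (F := fun y => k y * P.gibbsDensity N T y)
    (F' := fun x => partialP i k x * P.gibbsDensity N T x + k x * (-(x.2 i / T) * P.gibbsDensity N T x))
    (g := partialP i F) (g' := partialP i (partialP i F)) (by fun_prop) (by fun_prop) hPc hPPc hPcs hPPcs
    hline (fun x => hasLineDerivAt_partialP hF1d i x)
  have iL1 : Integrable fun x => T * partialP i (partialP i F) x * k x * P.gibbsDensity N T x :=
    (((continuous_const.mul hPPc).mul hk.continuous).mul hρc).integrable_of_hasCompactSupport
      (hPPcs.mul_left.mul_right.mul_right)
  have iL2 : Integrable fun x => x.2 i * partialP i F x * k x * P.gibbsDensity N T x :=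
    (((hpc.mul hPc).mul hk.continuous).mul hρc).integrable_of_hasCompactSupport
      (hPcs.mul_left.mul_right.mul_right)
  have hsplit : (fun x => (T * partialP i (partialP i F) x - x.2 i * partialP i F x) * k x *
      P.gibbsDensity N T x) = fun x => T * partialP i (partialP i F) x * k x * P.gibbsDensity N T x -
        x.2 i * partialP i F x * k x * P.gibbsDensity N T x := by
    funext x; ring
  rw [hsplit, integral_sub iL1 iL2]
  have h1 : ∫ x, T * partialP i (partialP i F) x * k x * P.gibbsDensity N T x =
      T * ∫ x, (k x * P.gibbsDensity N T x) * partialP i (partialP i F) x := by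
    rw [← integral_const_mul]
    exact integral_congr_ae (Eventually.of_forall fun x => by ring)
  rw [h1, e1]
  have iX : Integrable fun x => partialP i F x * partialP i k x * P.gibbsDensity N T x :=
    ((hPc.mul hPkc).mul hρc).integrable_of_hasCompactSupport (hPcs.mul_right.mul_right)
  have h2 : ∫ x, (partialP i k x * P.gibbsDensity N T x + k x * (-(x.2 i / T) * P.gibbsDensity N T x)) *
      partialP i F x = (∫ x, partialP i F x * partialP i k x * P.gibbsDensity N T x) -
        T⁻¹ * ∫ x, x.2 i * partialP i F x * k x * P.gibbsDensity N T x := by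
    rw [← integral_const_mul, ← integral_sub iX (iL2.const_mul _)]
    exact integral_congr_ae (Eventually.of_forall fun x => by ring)
  rw [h2]
  field_simp
  ring

/-- For `N ≥ 2`, the bath sum over the sites collapses to the two ends, for any site function `g`.
[folklore] -/
theorem sum_ite_ends_eq (hN : 2 ≤ N) (g : Fin N → ℝ) :
    (∑ i : Fin N, ((if i.val = 0 then g i else 0) + (if i.val = N - 1 then g i else 0))) =
      g ⟨0, by omega⟩ + g ⟨N - 1, by omega⟩ := by
  rw [Finset.sum_add_distrib]
  congr 1
  · rw [Finset.sum_eq_single ⟨0, by omega⟩]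
    · simp
    · intro i _ hi
      rw [if_neg]
      exact fun h0 => hi (Fin.ext h0)
    · intro h; exact absurd (Finset.mem_univ _) h
  · rw [Finset.sum_eq_single ⟨N - 1, by omega⟩]
    · simp
    · intro i _ hi
      rw [if_neg]
      exact fun h0 => hi (Fin.ext h0)
    · intro h; exact absurd (Finset.mem_univ _) h

/-! ### The energy estimate -/

section Pinned

variable {ω₂ lam β γ : ℝ} (hω : 0 < ω₂) (hl : 0 ≤ lam) (hβ : 0 ≤ β) (hγ : 0 ≤ γ) (hN : 2 ≤ N)
  {T : ℝ} (hT : 0 < T)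
include hω hl hβ hγ hN hT

/-- **The energy estimate.** For `k ∈ C²` with `L_{T,T} k = λ k` pointwise and `∫ k² e^{-H/T} < ∞`,
and the energy cutoff `χ_R` (`R > 0`, `M = sup|χ'|`):
`λ ∫ k² χ_R² e^{-H/T} ≤ 8 γ T M² R⁻¹ ∫ k² e^{-H/T}`. [folklore] -/
theorem energy_estimate (lam' : ℝ) {k : PhaseSpace N → ℝ} (hk : ContDiff ℝ 2 k)
    (hk2 : Integrable (fun x => k x ^ 2 * (pinnedChain ω₂ lam β γ).gibbsDensity N T x))
    (hgen : ∀ x, (pinnedChain ω₂ lam β γ).generator N T T k x = lam' * k x)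
    {M : ℝ} (hM : ∀ u, |deriv smoothCutoff u| ≤ M) {R : ℝ} (hR : 0 < R) :
    lam' * ∫ x, k x ^ 2 * (smoothCutoff ((pinnedChain ω₂ lam β γ).hamiltonian N x / R)) ^ 2 *
        (pinnedChain ω₂ lam β γ).gibbsDensity N T x ≤
      8 * γ * T * M ^ 2 / R * ∫ x, k x ^ 2 * (pinnedChain ω₂ lam β γ).gibbsDensity N T x := by
  set P := pinnedChain ω₂ lam β γ with hP
  have hU : ContDiff ℝ ∞ P.U := pinnedChain_contDiff_U ω₂ lam β γ
  have hV : ContDiff ℝ ∞ P.V := pinnedChain_contDiff_V ω₂ lam β γ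
  have hU1 : ContDiff ℝ 1 P.U := pinnedChain_contDiff_U ω₂ lam β γ
  have hV1 : ContDiff ℝ 1 P.V := pinnedChain_contDiff_V ω₂ lam β γ
  have hγ' : P.γ = γ := rfl
  set ρ := P.gibbsDensity N T with hρ
  set χ : PhaseSpace N → ℝ := fun x => smoothCutoff (P.hamiltonian N x / R) with hχ
  have hH : ContDiff ℝ ∞ (P.hamiltonian N) := P.contDiff_hamiltonian hU hV N
  have hH1 : ContDiff ℝ 1 (P.hamiltonian N) := P.contDiff_hamiltonian hU1 hV1 N
  have hHd : Differentiable ℝ (P.hamiltonian N) := hH.differentiable (by simp)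
  have hχs : ContDiff ℝ ∞ χ := contDiff_energyCutoff (ω₂ := ω₂) (lam := lam) (β := β) γ N R
  have hχc : HasCompactSupport χ := hasCompactSupport_energyCutoff hω hl hβ γ N hR
  have hχd : Differentiable ℝ χ := hχs.differentiable (by simp)
  have hχχd : Differentiable ℝ (fun y => χ y * χ y) := hχd.mul hχd
  have hkd : Differentiable ℝ k := hk.differentiable two_ne_zero
  have hρc : Continuous ρ := P.continuous_gibbsDensity hU.continuous hV.continuous N T
  have hk1 : ∀ i, ContDiff ℝ 1 (partialP i k) := fun i => contDiff_partialP hk (by norm_num) i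
  -- the test function `F = k χ²`
  set F : PhaseSpace N → ℝ := fun x => k x * (χ x * χ x) with hF
  have hχχs : ContDiff ℝ ∞ (fun x => χ x * χ x) := hχs.mul hχs
  have hFs : ContDiff ℝ 2 F := (hk.of_le le_rfl).mul (hχχs.of_le (by norm_cast))
  have hF1 : ContDiff ℝ 1 F := hFs.of_le (by norm_num)
  have hFc : HasCompactSupport F := (hχc.mul_left (f := χ)).mul_left
  have hFd : Differentiable ℝ F := hFs.differentiable two_ne_zero
  -- derivatives of `χ²` are functions of the energy: `{H, χ²} = 0` termwise
  have hψ : ∀ u, HasDerivAt (fun v => smoothCutoff (v / R) * smoothCutoff (v / R))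
      (smoothCutoff (u / R) * (deriv smoothCutoff (u / R) / R) +
        smoothCutoff (u / R) * (deriv smoothCutoff (u / R) / R)) u := fun u =>
    (hasDerivAt_smoothCutoff_div R u).mul (hasDerivAt_smoothCutoff_div R u) |>.congr_deriv (by ring)
  have hLχ : ∀ i x, x.2 i * partialQ i (fun y => χ y * χ y) x -
      partialQ i (P.hamiltonian N) x * partialP i (fun y => χ y * χ y) x = 0 := fun i x =>
    liouville_comp_hamiltonian_eq_zero P hHd hψ i x
  -- (X) the Liouville terms vanish: `∫ (A_i k) k χ² ρ = 0`
  have hX : ∀ i : Fin N, ∫ x, (x.2 i * partialQ i k x - partialQ i (P.hamiltonian N) x * partialP i k x) *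
      (k x * (χ x * χ x)) * ρ x = 0 := by
    intro i
    have hanti := integral_liouville_mul_mul_gibbsDensity P hU1 hV1 N T hF1 hFc (hk.of_le (by norm_num)) i
    -- `A_i F = χ² A_i k`
    have hprod : ∀ x, x.2 i * partialQ i F x - partialQ i (P.hamiltonian N) x * partialP i F x =
        (χ x * χ x) * (x.2 i * partialQ i k x - partialQ i (P.hamiltonian N) x * partialP i k x) := by
      intro x
      have hq := partialQ_mul hkd hχχd i x
      have hp := partialP_mul hkd hχχd i x
      simp only [hF] at hq hp ⊢
      rw [hq, hp]
      have := hLχ i x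
      linear_combination k x * this
    simp_rw [hprod] at hanti
    have e : ∫ x, (χ x * χ x) * (x.2 i * partialQ i k x - partialQ i (P.hamiltonian N) x * partialP i k x) *
        k x * ρ x = -∫ x, (x.2 i * partialQ i k x - partialQ i (P.hamiltonian N) x * partialP i k x) *
          (k x * (χ x * χ x)) * ρ x := by
      rw [hanti, ← integral_neg]
      exact integral_congr_ae (Eventually.of_forall fun x => by simp only [hF]; ring)
    have e' : ∫ x, (χ x * χ x) * (x.2 i * partialQ i k x - partialQ i (P.hamiltonian N) x * partialP i k x) *
        k x * ρ x = ∫ x, (x.2 i * partialQ i k x - partialQ i (P.hamiltonian N) x * partialP i k x) *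
          (k x * (χ x * χ x)) * ρ x :=
      integral_congr_ae (Eventually.of_forall fun x => by ring)
    linarith
  -- (Y) the bath terms: `∫ (S_b k) k χ² ρ ≤ (4M²T/R) ∫ k² ρ`
  have hY : ∀ i : Fin N, ∫ x, (T * partialP i (partialP i k) x - x.2 i * partialP i k x) *
      (k x * (χ x * χ x)) * ρ x ≤ T * (4 * M ^ 2 / R) * ∫ x, k x ^ 2 * ρ x := by
    intro i
    -- symmetry, then carré du champ
    have hsym := integral_bath_mul_mul_gibbsDensity P hU1 hV1 N T hT.ne' hFs hFc hk i
    have hcar := integral_bath_mul_gibbsDensity_eq_neg P hU1 hV1 N hT.ne' hFs hFc (hk.of_le (by norm_num)) i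
    have e0 : ∫ x, (T * partialP i (partialP i k) x - x.2 i * partialP i k x) * (k x * (χ x * χ x)) * ρ x =
        ∫ x, F x * (T * partialP i (partialP i k) x - x.2 i * partialP i k x) * ρ x :=
      integral_congr_ae (Eventually.of_forall fun x => by simp only [hF]; ring)
    rw [e0, ← hsym, hcar]
    -- pointwise: `-T ∂F ∂k ≤ T k² (∂χ)²` (complete the square), and `(∂χ)² ≤ 4M²/R`
    have hpt : ∀ x, -T * (partialP i F x * partialP i k x * ρ x) ≤ T * (4 * M ^ 2 / R) * (k x ^ 2 * ρ x) := by
      intro x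
      have hρ0 : 0 ≤ ρ x := (P.gibbsDensity_pos N T x).le
      have hdF : partialP i F x = k x * (2 * χ x * partialP i χ x) + χ x * χ x * partialP i k x := by
        have hp := partialP_mul hkd hχχd i x
        have hp2 := partialP_mul hχd hχd i x
        simp only [hF] at hp ⊢
        rw [hp]
        simp only [hχ] at hp2 ⊢
        rw [hp2]
        ring
      have hsq := sq_partialP_energyCutoff_le (lam := lam) (β := β) hl hβ hω.le γ N hR hM i x
      have h1 : -T * (partialP i F x * partialP i k x) ≤ T * (k x ^ 2 * (partialP i χ x) ^ 2) := by
        rw [hdF]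
        nlinarith [sq_nonneg (χ x * partialP i k x + k x * partialP i χ x), hT]
      have h2 : T * (k x ^ 2 * (partialP i χ x) ^ 2) ≤ T * (4 * M ^ 2 / R) * k x ^ 2 := by
        have : k x ^ 2 * (partialP i χ x) ^ 2 ≤ k x ^ 2 * (4 * M ^ 2 / R) :=
          mul_le_mul_of_nonneg_left hsq (sq_nonneg _)
        nlinarith
      have := mul_le_mul_of_nonneg_right (h1.trans h2) hρ0
      nlinarith
    -- integrate the pointwise bound
    have hPkc : Continuous (partialP i k) := (hk1 i).continuous
    have hPFc : Continuous (partialP i F) := continuous_partialP hFs two_ne_zero i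
    have hPFcs : HasCompactSupport (partialP i F) := hasCompactSupport_partialP hFd hFc i
    have iA : Integrable fun x => -T * (partialP i F x * partialP i k x * ρ x) :=
      (((hPFc.mul hPkc).mul hρc).integrable_of_hasCompactSupport (hPFcs.mul_right.mul_right)).const_mul _
    have iB : Integrable fun x => T * (4 * M ^ 2 / R) * (k x ^ 2 * ρ x) := hk2.const_mul _
    calc -T * ∫ x, partialP i F x * partialP i k x * ρ x
        = ∫ x, -T * (partialP i F x * partialP i k x * ρ x) := (integral_const_mul _ _).symm
      _ ≤ ∫ x, T * (4 * M ^ 2 / R) * (k x ^ 2 * ρ x) := integral_mono iA iB hpt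
      _ = T * (4 * M ^ 2 / R) * ∫ x, k x ^ 2 * ρ x := integral_const_mul _ _
  -- assemble: `λ ∫ k²χ²ρ = ∫ (Lk) kχ² ρ = Σ_i X_i + γ (Y₀ + Y₁)`
  set b₀ : Fin N := ⟨0, by omega⟩ with hb₀
  set b₁ : Fin N := ⟨N - 1, by omega⟩ with hb₁
  have hLk : ∀ x, P.generator N T T k x * (k x * (χ x * χ x)) * ρ x =
      (∑ i, (x.2 i * partialQ i k x - partialQ i (P.hamiltonian N) x * partialP i k x) *
        (k x * (χ x * χ x)) * ρ x) +
      P.γ * ((T * partialP b₀ (partialP b₀ k) x - x.2 b₀ * partialP b₀ k x) * (k x * (χ x * χ x)) * ρ x +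
        (T * partialP b₁ (partialP b₁ k) x - x.2 b₁ * partialP b₁ k x) * (k x * (χ x * χ x)) * ρ x) := by
    intro x
    rw [OscillatorChain.generator, sum_ite_ends_eq hN]
    simp only [add_mul, Finset.sum_mul]
    ring
  -- integrability of the Liouville terms
  have hWc : ∀ i, Continuous (partialQ i (P.hamiltonian N)) := fun i => P.continuous_partialQ_hamiltonian hH1 i
  have intA : ∀ i, Integrable (fun x => (x.2 i * partialQ i k x -
      partialQ i (P.hamiltonian N) x * partialP i k x) * (k x * (χ x * χ x)) * ρ x) := by
    intro i
    have hQkc : Continuous (partialQ i k) := continuous_partialQ hk two_ne_zero i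
    have hPkc : Continuous (partialP i k) := continuous_partialP hk two_ne_zero i
    refine Continuous.integrable_of_hasCompactSupport (by fun_prop) ?_
    exact (hFc.mul_left).mul_right
  have intS : ∀ i, Integrable (fun x => (T * partialP i (partialP i k) x - x.2 i * partialP i k x) *
      (k x * (χ x * χ x)) * ρ x) := by
    intro i
    have hPkc : Continuous (partialP i k) := (hk1 i).continuous
    have hPPkc : Continuous (partialP i (partialP i k)) := continuous_partialP (hk1 i) one_ne_zero i
    refine Continuous.integrable_of_hasCompactSupport (by fun_prop) ?_
    exact (hFc.mul_left).mul_right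
  have hmain : lam' * ∫ x, k x ^ 2 * χ x ^ 2 * ρ x = ∫ x, P.generator N T T k x * (k x * (χ x * χ x)) * ρ x := by
    rw [← integral_const_mul]
    refine integral_congr_ae (Eventually.of_forall fun x => ?_)
    dsimp only
    rw [hgen x]
    ring
  rw [hmain]
  simp_rw [hLk]
  have intB : Integrable (fun x => P.γ *
      ((T * partialP b₀ (partialP b₀ k) x - x.2 b₀ * partialP b₀ k x) * (k x * (χ x * χ x)) * ρ x +
        (T * partialP b₁ (partialP b₁ k) x - x.2 b₁ * partialP b₁ k x) * (k x * (χ x * χ x)) * ρ x)) :=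
    ((intS b₀).add (intS b₁)).const_mul P.γ
  have intAs : Integrable (fun x => ∑ i, (x.2 i * partialQ i k x -
      partialQ i (P.hamiltonian N) x * partialP i k x) * (k x * (χ x * χ x)) * ρ x) :=
    integrable_finsetSum _ fun i _ => intA i
  rw [integral_add intAs intB, integral_finsetSum _ (fun i _ => intA i), integral_const_mul,
    integral_add (intS b₀) (intS b₁)]
  simp only [hX, Finset.sum_const_zero, zero_add]
  have hI0 : 0 ≤ ∫ x, k x ^ 2 * ρ x := integral_nonneg fun x => mul_nonneg (sq_nonneg _) (P.gibbsDensity_pos N T x).le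
  rw [hγ']
  calc γ * ((∫ x, (T * partialP b₀ (partialP b₀ k) x - x.2 b₀ * partialP b₀ k x) * (k x * (χ x * χ x)) * ρ x) +
        ∫ x, (T * partialP b₁ (partialP b₁ k) x - x.2 b₁ * partialP b₁ k x) * (k x * (χ x * χ x)) * ρ x)
      ≤ γ * (T * (4 * M ^ 2 / R) * (∫ x, k x ^ 2 * ρ x) + T * (4 * M ^ 2 / R) * ∫ x, k x ^ 2 * ρ x) :=
        mul_le_mul_of_nonneg_left (add_le_add (hY b₀) (hY b₁)) hγ
    _ = 8 * γ * T * M ^ 2 / R * ∫ x, k x ^ 2 * ρ x := by ring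

/-- **`L²(e^{-H/T})` eigenfunctions of the equilibrium generator with positive eigenvalue vanish**
(the dissipativity estimate behind essential m-dissipativity of `(L, C_c^∞)` in `L²(μ_T)`): for the
pinned anharmonic chain (`ω₂ > 0`, `lam, β ≥ 0`, `γ ≥ 0`, `N ≥ 2`, `T > 0`), `λ > 0` and `k ∈ C²`
with `L_{T,T} k = λ k` pointwise and `∫ k² e^{-H/T} dx < ∞`: `k ≡ 0`. (Energy estimate
`energy_estimate` with `R → ∞`: `λ ∫ k² e^{-H/T} ≤ 0`.) [folklore] -/
theorem eq_zero_of_generator_eq_smul {lam' : ℝ} (hlam : 0 < lam') {k : PhaseSpace N → ℝ}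
    (hk : ContDiff ℝ 2 k)
    (hk2 : Integrable (fun x => k x ^ 2 * (pinnedChain ω₂ lam β γ).gibbsDensity N T x))
    (hgen : ∀ x, (pinnedChain ω₂ lam β γ).generator N T T k x = lam' * k x) :
    ∀ x, k x = 0 := by
  set P := pinnedChain ω₂ lam β γ with hP
  set ρ := P.gibbsDensity N T with hρ
  obtain ⟨M, -, hM⟩ := exists_bound_deriv_smoothCutoff
  set I : ℝ := ∫ x, k x ^ 2 * ρ x with hI
  have hI0 : 0 ≤ I := integral_nonneg fun x => mul_nonneg (sq_nonneg _) (P.gibbsDensity_pos N T x).le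
  -- `∫ k² χ_R² ρ → ∫ k² ρ`
  have hlim : Tendsto (fun R : ℝ => ∫ x, k x ^ 2 * (smoothCutoff (P.hamiltonian N x / R)) ^ 2 * ρ x)
      atTop (𝓝 I) := by
    refine tendsto_integral_filter_of_dominated_convergence (fun x => k x ^ 2 * ρ x) ?_ ?_ hk2 ?_
    · refine Eventually.of_forall fun R => ?_
      refine Continuous.aestronglyMeasurable ?_
      exact ((hk.continuous.pow 2).mul ((contDiff_smoothCutoff (n := ⊤)).continuous.comp
        ((pinnedChain_continuous_hamiltonian ω₂ lam β γ N).div_const R) |>.pow 2)).mul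
        (pinnedChain_continuous_gibbsDensity ω₂ lam β γ N T)
    · refine Eventually.of_forall fun R => Eventually.of_forall fun x => ?_
      have h01 := energyCutoff_mem_Icc P N R x
      have hρ0 : 0 ≤ ρ x := (P.gibbsDensity_pos N T x).le
      rw [Real.norm_eq_abs, abs_of_nonneg (by positivity)]
      have : (smoothCutoff (P.hamiltonian N x / R)) ^ 2 ≤ 1 := by
        rw [sq_le_one_iff₀ h01.1]; exact h01.2
      calc k x ^ 2 * smoothCutoff (P.hamiltonian N x / R) ^ 2 * ρ x
          ≤ k x ^ 2 * 1 * ρ x := by gcongr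
        _ = k x ^ 2 * ρ x := by ring
    · refine Eventually.of_forall fun x => ?_
      have h := (tendsto_energyCutoff_atTop P N x).pow 2
      simpa using (tendsto_const_nhds.mul h).mul tendsto_const_nhds
  -- the right-hand side of the energy estimate tends to `0`
  have hrhs : Tendsto (fun R : ℝ => 8 * γ * T * M ^ 2 / R * I) atTop (𝓝 0) := by
    have h : Tendsto (fun R : ℝ => 8 * γ * T * M ^ 2 * I / R) atTop (𝓝 0) :=
      tendsto_const_nhds.div_atTop tendsto_id
    refine h.congr fun R => by ring
  have hle : lam' * I ≤ 0 := by
    refine le_of_tendsto_of_tendsto (hlim.const_mul lam') hrhs ?_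
    filter_upwards [eventually_gt_atTop (0 : ℝ)] with R hR
    exact energy_estimate hω hl hβ hγ hN hT lam' hk hk2 hgen hM hR
  have hI : I = 0 := le_antisymm (by nlinarith) hI0
  -- `∫ k² ρ = 0` forces `k = 0`
  have hae : (fun x => k x ^ 2 * ρ x) =ᵐ[volume] 0 := by
    rw [← integral_eq_zero_iff_of_nonneg (fun x => mul_nonneg (sq_nonneg _) (P.gibbsDensity_pos N T x).le) hk2]
    exact hI
  have hk0 : k =ᵐ[volume] fun _ => 0 := by
    filter_upwards [hae] with x hx
    simp only [Pi.zero_apply, mul_eq_zero] at hx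
    rcases hx with hx | hx
    · exact pow_eq_zero_iff two_ne_zero |>.1 hx
    · exact absurd hx (P.gibbsDensity_pos N T x).ne'
  have := (Continuous.ae_eq_iff_eq volume hk.continuous continuous_const).1 hk0
  exact fun x => congrFun this x

end Pinned

end Summit.AtomisticToContinuum.FouriersLaw.Theorems.OddSectorIrreversibility

end
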